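import Mathlib
import Summits.Ventures.PercRepro.TriangleCapThreeBelowFourTrianglesC

/-!
# PercRepro — FOUR BELOW THE DIAGONAL: THE CRUDE COUNT AND THE TRANSVERSAL PAIRS OF THREE TRIANGLES
(p3, gen 39; part 120)

The crude count of gen 38's four-triangle module, at `r = 4` and for any number `j` of triangles:
`3 Σ deficit = 3 Σ_{T₃} deficit + 3 Σ₀ ≥ (k − 3)|T₃| + 3 (2m − |T₃| − |F|)` with `|T₃| = 6j` and `F` the
«transversal» pairs (ordered adjacent pairs in no triangle with deficit `0`), so
`Σ_v d(v)² + 4 (k − 5) ≤ m k` as soon as `|F| + 18 j + 8 k ≤ 2m + 2 j k + 40` (**`stability_four_of_transversal`**).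
A transversal pair meets every triangle (`mem_of_deficit_zero`) and no triangle contains both its ends
(`not_both_mem`); hence for three triangles: vertex-disjoint ⇒ `F = ∅`; one shared vertex `t` (`T₁ ∩ T₂ = {t}`,
`T₃` disjoint from both) ⇒ `F ⊆ {t} × T₃ ∪ T₃ × {t}`, `|F| ≤ 6`; a path `T₁ ∩ T₂ = {t}`, `T₂ ∩ T₃ = {t′}`,
`T₁ ∩ T₃ = ∅` carrying every triangle ⇒ `F = ∅` (a transversal pair would close a fourth triangle on `t t′`);
the windmill (every pair meets in `t`) ⇒ `F ⊆ {t} × Sᶜ ∪ Sᶜ × {t}`, `|F| ≤ 2 (k − 7)`.  Axioms: standard.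
-/

namespace PercRepro

namespace TriangleCap

namespace C047

open Finset

variable {V : Type*} [Fintype V] [DecidableEq V]

/-- **THE CRUDE COUNT AT `r = 4`:** `K₄⁻`-free, `k ≥ 10`, `|T₃| = 6 j`, and
`|F| + 18 j + 8 k ≤ 2m + 2 j k + 40` for the transversal pairs `F` ⇒ `Σ_v d(v)² + 4 (k − 5) ≤ m k`. -/
theorem stability_four_of_transversal (D : SimpleGraph V) [DecidableRel D.Adj] (hK : K4mFree D)
    (hk : 10 ≤ Fintype.card V) (j : ℕ) (hT3 : (triangles3 D).card = 6 * j)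
    (hF : ((adjPairsAll D).filter (fun p => codeg D p = 0 ∧ deficit D p = 0)).card + 18 * j + 8 * Fintype.card V ≤
      2 * D.edgeFinset.card + 2 * j * Fintype.card V + 40) :
    ∑ v, deg D v * deg D v + 4 * (Fintype.card V - 5) ≤ D.edgeFinset.card * Fintype.card V := by
  have hsplit := sum_deficit_split D hK
  have hout := card_mul_add_two_mul_sum_outer_le D hK
  have hc0 := card_codeg_zero_add_card_triangles3 D hK
  have hle := card_codeg_zero_le_sum_deficit_add D
  have hid := two_mul_sum_deg_sq_add_sum_deficit D
  rw [hT3] at hout hc0 hid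
  obtain ⟨k', hk'⟩ : ∃ k', Fintype.card V = k' + 10 := ⟨Fintype.card V - 10, by omega⟩
  rw [hk'] at hout hid hF ⊢
  have e : k' + 10 - 5 = k' + 5 := by omega
  rw [e]
  have hout' : 6 * (j * k') + 42 * j ≤ 3 * ∑ t ∈ triangles3 D, deficit D t.1 := by
    have : (k' + 10) * (6 * j) = 6 * (j * k') + 60 * j := by ring
    omega
  have hF' : ((adjPairsAll D).filter (fun p => codeg D p = 0 ∧ deficit D p = 0)).card + 8 * k' + 40 ≤
      2 * D.edgeFinset.card + 2 * (j * k') + 2 * j := by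
    have : 2 * j * (k' + 10) = 2 * (j * k') + 20 * j := by ring
    omega
  have hid' : 2 * ∑ v, deg D v * deg D v + ∑ p ∈ adjPairsAll D, deficit D p =
      2 * (D.edgeFinset.card * k') + 20 * D.edgeFinset.card + 6 * j := by
    have : 2 * D.edgeFinset.card * (k' + 10) = 2 * (D.edgeFinset.card * k') + 20 * D.edgeFinset.card := by ring
    omega
  have hgoal : D.edgeFinset.card * (k' + 10) = D.edgeFinset.card * k' + 10 * D.edgeFinset.card := by ring
  rw [hgoal]
  omega

/-- A transversal pair meets every 3-clique of a `K₄⁻`-free graph. -/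
theorem transversal_hits (D : SimpleGraph V) [DecidableRel D.Adj] (hK : K4mFree D) {T : Finset V}
    (hT : T.card = 3) (hcl : ∀ x ∈ T, ∀ y ∈ T, x ≠ y → D.Adj x y) {p : V × V}
    (hp : p ∈ (adjPairsAll D).filter (fun p => codeg D p = 0 ∧ deficit D p = 0)) : p.1 ∈ T ∨ p.2 ∈ T := by
  rw [mem_transversal] at hp
  exact mem_of_deficit_zero D hT (fun z hz => degIn_le_one_of_clique D hK hT hcl hz) hp.2.2

omit [Fintype V] [DecidableEq V] in
/-- No 3-clique contains both ends of a transversal pair. -/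
theorem transversal_not_both (D : SimpleGraph V) [DecidableRel D.Adj] [Fintype V] [DecidableEq V] {T : Finset V}
    (hT : T.card = 3) (hcl : ∀ x ∈ T, ∀ y ∈ T, x ≠ y → D.Adj x y) {p : V × V}
    (hp : p ∈ (adjPairsAll D).filter (fun p => codeg D p = 0 ∧ deficit D p = 0)) (h1 : p.1 ∈ T) (h2 : p.2 ∈ T) :
    False := by
  rw [mem_transversal] at hp
  exact not_both_mem D hT hcl hp.1 hp.2.1 h1 h2

/-- **Three vertex-disjoint triangles have no transversal pair.** -/
theorem transversal_eq_empty_of_three_disjoint (D : SimpleGraph V) [DecidableRel D.Adj] (hK : K4mFree D)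
    (T₁ T₂ T₃ : Finset V) (h₁ : T₁.card = 3) (h₂ : T₂.card = 3) (h₃ : T₃.card = 3)
    (h12 : Disjoint T₁ T₂) (h13 : Disjoint T₁ T₃) (h23 : Disjoint T₂ T₃)
    (hcl₁ : ∀ x ∈ T₁, ∀ y ∈ T₁, x ≠ y → D.Adj x y) (hcl₂ : ∀ x ∈ T₂, ∀ y ∈ T₂, x ≠ y → D.Adj x y)
    (hcl₃ : ∀ x ∈ T₃, ∀ y ∈ T₃, x ≠ y → D.Adj x y) :
    (adjPairsAll D).filter (fun p => codeg D p = 0 ∧ deficit D p = 0) = ∅ := by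
  rw [eq_empty_iff_forall_notMem]
  intro p hp
  have e1 := transversal_hits D hK h₁ hcl₁ hp
  have e2 := transversal_hits D hK h₂ hcl₂ hp
  have e3 := transversal_hits D hK h₃ hcl₃ hp
  rw [disjoint_left] at h12 h13 h23
  rcases e1 with e1 | e1 <;> rcases e2 with e2 | e2 <;> rcases e3 with e3 | e3
  · exact h12 e1 e2
  · exact h12 e1 e2
  · exact h13 e1 e3
  · exact h23 e2 e3
  · exact h23 e2 e3
  · exact h13 e1 e3
  · exact h12 e1 e2
  · exact h12 e1 e2

/-- **One shared vertex:** the transversal pairs of `T₁ ∩ T₂ = {t}`, `T₃` disjoint from both, lie in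
`{t} × T₃ ∪ T₃ × {t}`. -/
theorem transversal_subset_of_one_shared (D : SimpleGraph V) [DecidableRel D.Adj] (hK : K4mFree D)
    (T₁ T₂ T₃ : Finset V) (h₁ : T₁.card = 3) (h₂ : T₂.card = 3) (h₃ : T₃.card = 3) {t : V}
    (h12 : T₁ ∩ T₂ = {t}) (h13 : Disjoint T₁ T₃) (h23 : Disjoint T₂ T₃)
    (hcl₁ : ∀ x ∈ T₁, ∀ y ∈ T₁, x ≠ y → D.Adj x y) (hcl₂ : ∀ x ∈ T₂, ∀ y ∈ T₂, x ≠ y → D.Adj x y)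
    (hcl₃ : ∀ x ∈ T₃, ∀ y ∈ T₃, x ≠ y → D.Adj x y) :
    (adjPairsAll D).filter (fun p => codeg D p = 0 ∧ deficit D p = 0) ⊆ ({t} ×ˢ T₃) ∪ (T₃ ×ˢ {t}) := by
  intro p hp
  have e1 := transversal_hits D hK h₁ hcl₁ hp
  have e2 := transversal_hits D hK h₂ hcl₂ hp
  have e3 := transversal_hits D hK h₃ hcl₃ hp
  have hmem12 : ∀ x, x ∈ T₁ → x ∈ T₂ → x = t := by
    intro x hx1 hx2
    have : x ∈ T₁ ∩ T₂ := mem_inter.mpr ⟨hx1, hx2⟩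
    rw [h12, mem_singleton] at this
    exact this
  rw [disjoint_left] at h13 h23
  rw [mem_union, mem_product, mem_product, mem_singleton, mem_singleton]
  rcases e1 with e1 | e1 <;> rcases e2 with e2 | e2 <;> rcases e3 with e3 | e3
  · exact absurd e3 (h13 e1)
  · exact Or.inl ⟨hmem12 p.1 e1 e2, e3⟩
  · exact absurd e3 (h13 e1)
  · exact absurd e3 (h23 e2)
  · exact absurd e3 (h23 e2)
  · exact absurd e3 (h13 e1)
  · exact Or.inr ⟨e3, hmem12 p.2 e1 e2⟩
  · exact absurd e3 (h13 e1)

/-- **A path of three triangles has no transversal pair:** `T₁ ∩ T₂ = {t}`, `T₂ ∩ T₃ = {t′}`, `T₁ ∩ T₃ = ∅`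
carrying every triangle — a transversal pair through `t` and `T₃ ∖ {t′}` (or `t′` and `T₁ ∖ {t}`) would close a
fourth triangle on `t t′`. -/
theorem transversal_eq_empty_of_path (D : SimpleGraph V) [DecidableRel D.Adj] (hK : K4mFree D)
    (T₁ T₂ T₃ : Finset V) (h₁ : T₁.card = 3) (h₂ : T₂.card = 3) (h₃ : T₃.card = 3) {t t' : V}
    (h12 : T₁ ∩ T₂ = {t}) (h23 : T₂ ∩ T₃ = {t'}) (h13 : Disjoint T₁ T₃)
    (hcl₁ : ∀ x ∈ T₁, ∀ y ∈ T₁, x ≠ y → D.Adj x y) (hcl₂ : ∀ x ∈ T₂, ∀ y ∈ T₂, x ≠ y → D.Adj x y)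
    (hcl₃ : ∀ x ∈ T₃, ∀ y ∈ T₃, x ≠ y → D.Adj x y)
    (hT : ∀ x y z, D.Adj x y → D.Adj x z → D.Adj y z →
      (x ∈ T₁ ∧ y ∈ T₁) ∨ (x ∈ T₂ ∧ y ∈ T₂) ∨ (x ∈ T₃ ∧ y ∈ T₃)) :
    (adjPairsAll D).filter (fun p => codeg D p = 0 ∧ deficit D p = 0) = ∅ := by
  have ht1 : t ∈ T₁ := (mem_inter.mp (by rw [h12]; exact mem_singleton_self t)).1
  have ht2 : t ∈ T₂ := (mem_inter.mp (by rw [h12]; exact mem_singleton_self t)).2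
  have ht'2 : t' ∈ T₂ := (mem_inter.mp (by rw [h23]; exact mem_singleton_self t')).1
  have ht'3 : t' ∈ T₃ := (mem_inter.mp (by rw [h23]; exact mem_singleton_self t')).2
  have hmem12 : ∀ x, x ∈ T₁ → x ∈ T₂ → x = t := by
    intro x hx1 hx2
    have : x ∈ T₁ ∩ T₂ := mem_inter.mpr ⟨hx1, hx2⟩
    rw [h12, mem_singleton] at this
    exact this
  have hmem23 : ∀ x, x ∈ T₂ → x ∈ T₃ → x = t' := by
    intro x hx2 hx3
    have : x ∈ T₂ ∩ T₃ := mem_inter.mpr ⟨hx2, hx3⟩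
    rw [h23, mem_singleton] at this
    exact this
  rw [disjoint_left] at h13
  have htt' : t ≠ t' := fun h => h13 ht1 (h ▸ ht'3)
  have htt'adj : D.Adj t t' := hcl₂ t ht2 t' ht'2 htt'
  -- a transversal pair `(x, y)` with `x ∈ T₁`, `y ∈ T₃` closes a fourth triangle
  have key : ∀ x y, D.Adj x y → codeg D (x, y) = 0 → x ∈ T₁ → y ∈ T₃ → (x ∈ T₂ ∨ y ∈ T₂) → False := by
    intro x y hxy h0 hx hy h2
    rcases h2 with hx2 | hy2
    · -- `x = t`, `y ∈ T₃`: `y ≠ t′` (else both in `T₂`), and `x y t′` is a triangle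
      have hxt := hmem12 x hx hx2
      have hyt' : y ≠ t' := by
        intro h
        exact not_both_mem D h₂ hcl₂ hxy h0 hx2 (h ▸ ht'2)
      have hxt' : D.Adj x t' := hcl₂ x hx2 t' ht'2 (by rw [hxt]; exact htt')
      have hyt'adj : D.Adj y t' := hcl₃ y hy t' ht'3 hyt'
      rcases hT x y t' hxy hxt' hyt'adj with h | h | h
      · exact h13 h.2 hy
      · exact not_both_mem D h₂ hcl₂ hxy h0 h.1 h.2
      · exact h13 hx h.1
    · -- `y = t′`, `x ∈ T₁`: `x ≠ t` (else both in `T₂`), and `x y t` is a triangle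
      have hyt := hmem23 y hy2 hy
      have hxt : x ≠ t := by
        intro h
        exact not_both_mem D h₂ hcl₂ hxy h0 (h ▸ ht2) hy2
      have hxtadj : D.Adj x t := hcl₁ x hx t ht1 hxt
      have hytadj : D.Adj y t := hcl₂ y hy2 t ht2 (by rw [hyt]; exact htt'.symm)
      rcases hT x y t hxy hxtadj hytadj with h | h | h
      · exact h13 h.2 hy
      · exact hxt (hmem12 x hx h.1)
      · exact h13 hx h.1
  rw [eq_empty_iff_forall_notMem]
  intro p hp
  have e1 := transversal_hits D hK h₁ hcl₁ hp
  have e2 := transversal_hits D hK h₂ hcl₂ hp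
  have e3 := transversal_hits D hK h₃ hcl₃ hp
  have hp' := hp
  rw [mem_transversal] at hp'
  obtain ⟨hadj, h0, -⟩ := hp'
  have h0' : codeg D (p.2, p.1) = 0 := by
    unfold codeg at h0 ⊢
    rw [card_eq_zero, filter_eq_empty_iff] at h0 ⊢
    intro z hz hz'
    exact h0 hz ⟨hz'.2, hz'.1⟩
  rcases e1 with e1 | e1 <;> rcases e3 with e3 | e3
  · exact h13 e1 e3
  · exact key p.1 p.2 hadj h0 e1 e3 e2
  · exact key p.2 p.1 hadj.symm h0' e1 e3 (by rcases e2 with e2 | e2; exact Or.inr e2; exact Or.inl e2)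
  · exact h13 e1 e3

/-- **The windmill:** the transversal pairs of three triangles pairwise meeting in `t` lie in
`{t} × Sᶜ ∪ Sᶜ × {t}`, `S = T₁ ∪ T₂ ∪ T₃`. -/
theorem transversal_subset_of_windmill (D : SimpleGraph V) [DecidableRel D.Adj] (hK : K4mFree D)
    (T₁ T₂ T₃ : Finset V) (h₁ : T₁.card = 3) (h₂ : T₂.card = 3) (h₃ : T₃.card = 3) {t : V}
    (h12 : T₁ ∩ T₂ = {t}) (h13 : T₁ ∩ T₃ = {t}) (h23 : T₂ ∩ T₃ = {t})
    (hcl₁ : ∀ x ∈ T₁, ∀ y ∈ T₁, x ≠ y → D.Adj x y) (hcl₂ : ∀ x ∈ T₂, ∀ y ∈ T₂, x ≠ y → D.Adj x y)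
    (hcl₃ : ∀ x ∈ T₃, ∀ y ∈ T₃, x ≠ y → D.Adj x y) :
    (adjPairsAll D).filter (fun p => codeg D p = 0 ∧ deficit D p = 0) ⊆
      ({t} ×ˢ (T₁ ∪ T₂ ∪ T₃)ᶜ) ∪ ((T₁ ∪ T₂ ∪ T₃)ᶜ ×ˢ {t}) := by
  intro p hp
  have e1 := transversal_hits D hK h₁ hcl₁ hp
  have e2 := transversal_hits D hK h₂ hcl₂ hp
  have e3 := transversal_hits D hK h₃ hcl₃ hp
  have hmem : ∀ {T T' : Finset V}, T ∩ T' = {t} → ∀ x, x ∈ T → x ∈ T' → x = t := by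
    intro T T' h x hx hx'
    have : x ∈ T ∩ T' := mem_inter.mpr ⟨hx, hx'⟩
    rw [h, mem_singleton] at this
    exact this
  have ht1 : t ∈ T₁ := (mem_inter.mp (by rw [h12]; exact mem_singleton_self t)).1
  have ht2 : t ∈ T₂ := (mem_inter.mp (by rw [h12]; exact mem_singleton_self t)).2
  have ht3 : t ∈ T₃ := (mem_inter.mp (by rw [h13]; exact mem_singleton_self t)).2
  have hnb1 := fun h1 h2 => transversal_not_both D h₁ hcl₁ hp h1 h2
  have hnb2 := fun h1 h2 => transversal_not_both D h₂ hcl₂ hp h1 h2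
  have hnb3 := fun h1 h2 => transversal_not_both D h₃ hcl₃ hp h1 h2
  rw [mem_union, mem_product, mem_product, mem_singleton, mem_singleton, mem_compl, mem_compl, mem_union,
    mem_union, mem_union, mem_union]
  -- the end in two of the triangles is `t`, the other end is off `S`
  rcases e1 with e1 | e1 <;> rcases e2 with e2 | e2 <;> rcases e3 with e3 | e3
  · refine Or.inl ⟨hmem h12 p.1 e1 e2, fun h => ?_⟩
    rcases h with (h | h) | h
    · exact hnb1 e1 h
    · exact hnb2 e2 h
    · exact hnb3 e3 h
  · have hx := hmem h12 p.1 e1 e2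
    have : p.1 ∈ T₃ := by rw [hx]; exact ht3
    exact (hnb3 this e3).elim
  · have hx := hmem h13 p.1 e1 e3
    have : p.1 ∈ T₂ := by rw [hx]; exact ht2
    exact (hnb2 this e2).elim
  · have hy := hmem h23 p.2 e2 e3
    have : p.2 ∈ T₁ := by rw [hy]; exact ht1
    exact (hnb1 e1 this).elim
  · have hx := hmem h23 p.1 e2 e3
    have : p.1 ∈ T₁ := by rw [hx]; exact ht1
    exact (hnb1 this e1).elim
  · have hy := hmem h13 p.2 e1 e3
    have : p.2 ∈ T₂ := by rw [hy]; exact ht2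
    exact (hnb2 e2 this).elim
  · have hy := hmem h12 p.2 e1 e2
    have : p.2 ∈ T₃ := by rw [hy]; exact ht3
    exact (hnb3 e3 this).elim
  · refine Or.inr ⟨fun h => ?_, hmem h12 p.2 e1 e2⟩
    rcases h with (h | h) | h
    · exact hnb1 h e1
    · exact hnb2 h e2
    · exact hnb3 h e3

end C047

end TriangleCap

end PercRepro
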